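import Summits.CriticalPhenomena.PercolationContinuityZ3.Theorems.PercNearOneGluingNoHeavyLowerTailHalfLeSevenForms
import Summits.CriticalPhenomena.PercolationContinuityZ3.Theorems.PercNearOneGluingNoHeavyLowerTailTypedReductions
import Literature.Probability.Percolation.TreeGraphBound
import HarnessLib

/-!
# `NoHeavyLowerTail` (stmt-CriticalPhenomena-4575), line fat-minority-linear — the MAJORITY SPLIT
# of the stub `stub_fatMinorityLinear`: the no-majority class is closed (constant 4), and the
# residual is a one-cut event AT THE OBSERVER

Notation: `A` the relay set, `o ∉ A` the observer, `N = #{a ∈ A : o ↔ a}`, `η ≥ max_{a,a'∈A} P(a ↮ a')`,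
and `G − o` the graph with the observer deleted (`{x ↔ y in {o}ᶜ}` = `openConnIn {o}ᶜ x y`).
Split every configuration according to whether SOME open cluster of `G − o` contains a strict
majority of the relays:

* `NoMaj = {ω | ∀ v, 2 · #{a ∈ A : v ↔ a in {o}ᶜ} ≤ |A|}` (no relay-majority cluster off `o`);
* `MM = {ω | o ↔ A ∧ ∃ v, |A| < 2 · #{a ∈ A : v ↔ a in {o}ᶜ} ∧ o ↮ v}` ("MAJORITY MISS": off `o`
  there is a relay-majority cluster, `o` is joined to some relay, but NOT to that cluster — i.e.
  every edge from `o` into the majority cluster is closed: a single cut, located at the observer).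

Results (sorry-free):

* `openConn_iff_openConnIn_compl_of_not_openConn` — if `o ↮ a` then `a ↔ a'` iff `a ↔ a'` in
  `G − o` (an open path from `a` cannot visit `o`).
* `noMajority_notConn_le` — for `a ∈ A`: `P(NoMaj ∩ {o ↮ a}) ≤ 2η`.  On the event the cluster of
  `a` avoids `o`, hence is a cluster of `G − o`, hence holds at most half of the relays, so `a` is
  cut from `≥ |A|/2` relays; first-moment counting against `∑_{a'} P(a ↮ a') ≤ |A| η`.
* `minority_noMajority_le` — **the no-majority class of the stub, constant 4, no `P(o ↮ A)` term and
  no `d₀`:** `P({2N ≤ |A|} ∩ NoMaj) ≤ 4η` (`A ≠ ∅`).  On `{2N ≤ |A|}` at least half of the relays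
  are missed by `o`; sum the previous bound over `a ∈ A`.
* `fatMinorityLinear_of_majorityMiss` — `MajorityMiss(C) : P(MM) ≤ C (P(o ↮ A) + η)` implies the
  registered stub `stub_fatMinorityLinear` (with `d₀ = 0`, constant `C + 4`), because
  `{0 < N, 2N ≤ |A|} ⊆ ({2N ≤ |A|} ∩ NoMaj) ∪ MM`;
  `noHeavyLowerTail_of_majorityMiss` composes with the landed `noHeavyLowerTail_of_fatMinorityLinear`
  to conclude the crux by name.
* `majorityMiss_of_fatMinorityZero` — conversely `MM ⊆ {0 < N, 2N ≤ |A|}`, so the stub at `d₀ = 0`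
  with constant `C` gives `MajorityMiss(C)`: the two are EQUIVALENT up to the additive constant 4.

Reading (the obstruction, named).  The whole content of the fat-minority stub — equivalently (file
`…FatMinorityReductions`) of linear gluing / the linear lower-tail form / one-cut up to constants —
is the MAJORITY-MISS event: conditionally on the configuration off `o`, the relay-majority cluster
`K` of `G − o` exists and the observer's edges into `K` are all closed while some edge into a
minority relay cluster is open.  Given the configuration off `o` this has probability
`q_K (1 − q_rest)` against `P(o ↮ A | ·) = q_K q_rest` (`q_S = ∏_{v ∈ S} (1 − w(o,v))`), and for a
FIXED pair `a ∈ K`, `a' ∉ K` the conditional disconnection probability is `≥ q_K`; what a proof must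
control is how the minority relays `A ∖ K` move with the configuration (for each fixed `a'`,
`E[q_K ; a' ∉ K] ≤ 2η` by the counting above) — the "random stray relays near the observer's
neighbourhood" regime, cf. the two-blob equality family of the one-cut census (ttrl j028329) where
`A ∖ K` is deterministic and `P(MM) = η` exactly.
-/

noncomputable section

namespace Summit.CriticalPhenomena.PercolationContinuityZ3.Theorems

open MeasureTheory Set Literature.Probability.LatticeModels Literature.Probability.Percolation
open Summit.CriticalPhenomena.PercolationContinuityZ3.Theses.PercNearOneGluing
open scoped Classical BigOperators

/-! ## Paths avoiding the observer -/

/-- If `o ↮ a` then `a ↔ a'` holds iff `a ↔ a'` in `G − o` (`openConnIn {o}ᶜ`): an open walk from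
`a` that visited `o` would join `a` to `o`. [folklore] -/
theorem openConn_iff_openConnIn_compl_of_not_openConn {n : ℕ} {ω : BondConfig (Fin n)}
    {o a a' : Fin n} (h : ω ∉ (openConn o a : Set (BondConfig (Fin n)))) :
    ω ∈ (openConn a a' : Set (BondConfig (Fin n))) ↔
      ω ∈ (openConnIn (({o} : Set (Fin n))ᶜ) a a' : Set (BondConfig (Fin n))) := by
  refine ⟨fun haa' => ?_, fun h' => openConnIn_subset_openConn _ _ _ h'⟩
  obtain ⟨p⟩ := (haa' : (openGraph ω).Reachable a a')
  have hS : ∀ z ∈ p.support, z ∈ (({o} : Set (Fin n))ᶜ : Set (Fin n)) := by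
    intro z hz
    simp only [Set.mem_compl_iff, Set.mem_singleton_iff]
    rintro rfl
    exact h (p.takeUntil z hz).reachable.symm
  exact ⟨hS _ p.start_mem_support, hS _ p.end_mem_support, ⟨p.induce _ hS⟩⟩

/-- If `o ↔ v` then every relay joined to `v` off `o` is joined to `o`. [folklore] -/
theorem openConn_of_openConn_of_openConnIn {n : ℕ} {ω : BondConfig (Fin n)} {o v a : Fin n}
    {S : Set (Fin n)} (hov : ω ∈ (openConn o v : Set (BondConfig (Fin n))))
    (hva : ω ∈ (openConnIn S v a : Set (BondConfig (Fin n)))) :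
    ω ∈ (openConn o a : Set (BondConfig (Fin n))) := by
  have h1 : (openGraph ω).Reachable o v := hov
  have h2 : (openGraph ω).Reachable v a := openConnIn_subset_openConn _ _ _ hva
  exact h1.trans h2

/-! ## The no-majority class -/

/-- **No-majority, one relay.** If off `o` no open cluster holds more than half of the relays
(`∀ v, 2 · #{a' ∈ A : v ↔ a' in {o}ᶜ} ≤ |A|`) and `o ↮ a` for a relay `a ∈ A`, then `a` is cut from
at least `|A|/2` relays; hence `P(NoMaj ∩ {o ↮ a}) ≤ 2 · max_{a'} P(a ↮ a')`. [folklore] -/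
theorem noMajority_notConn_le {n : ℕ} (w : Sym2 (Fin n) → unitInterval) (A : Finset (Fin n))
    (o a : Fin n) (η : ℝ) (ha : a ∈ A)
    (hpair : ∀ a' ∈ A, (prodBernoulli w).real (openConn a a' : Set (BondConfig (Fin n)))ᶜ ≤ η) :
    (prodBernoulli w).real ({ω : BondConfig (Fin n) | ∀ v : Fin n,
        2 * (A.filter fun a' => ω ∈ openConnIn (({o} : Set (Fin n))ᶜ) v a').card ≤ A.card} ∩
        (openConn o a : Set (BondConfig (Fin n)))ᶜ) ≤ 2 * η := by
  have hmeas : ∀ s : Set (BondConfig (Fin n)), MeasurableSet s :=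
    fun _ => MeasurableSet.of_discrete
  set P := prodBernoulli w with hP
  set D : Set (BondConfig (Fin n)) := {ω : BondConfig (Fin n) | ∀ v : Fin n,
      2 * (A.filter fun a' => ω ∈ openConnIn (({o} : Set (Fin n))ᶜ) v a').card ≤ A.card} ∩
      (openConn o a : Set (BondConfig (Fin n)))ᶜ with hD
  set m : ℝ := (A.card : ℝ) with hm
  have hmpos : 0 < m := by rw [hm]; exact_mod_cast Finset.card_pos.2 ⟨a, ha⟩
  have hcount : m / 2 * P.real D ≤
      ∑ a' ∈ A, P.real (D ∩ (openConn a a' : Set (BondConfig (Fin n)))ᶜ) := by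
    refine halfLeSevenForms_mul_measureReal_le_sum_inter P A
      (fun a' => (openConn a a' : Set (BondConfig (Fin n)))ᶜ) (fun _ _ => hmeas _) (hmeas D)
      (m / 2) fun ω hω => ?_
    have hind : ∀ a' ∈ A,
        ((openConn a a' : Set (BondConfig (Fin n)))ᶜ).indicator (fun _ => (1 : ℝ)) ω =
          if ¬ ω ∈ (openConn a a' : Set (BondConfig (Fin n))) then (1 : ℝ) else 0 := by
      intro a' _
      by_cases h' : ω ∈ (openConn a a' : Set (BondConfig (Fin n)))
      · rw [if_neg (not_not.2 h'), Set.indicator_of_notMem (Set.notMem_compl_iff.2 h')]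
      · rw [if_pos h', Set.indicator_of_mem (show ω ∈ (openConn a a' : Set (BondConfig (Fin n)))ᶜ
          from h')]
    rw [Finset.sum_congr rfl hind, Finset.sum_boole]
    obtain ⟨hNoMaj, hoa⟩ := hω
    have hoa' : ω ∉ (openConn o a : Set (BondConfig (Fin n))) := hoa
    -- the relays joined to `a` are joined to `a` off `o`
    have hfilt : (A.filter fun a' => ω ∈ (openConn a a' : Set (BondConfig (Fin n)))) =
        (A.filter fun a' => ω ∈ openConnIn (({o} : Set (Fin n))ᶜ) a a') :=
      Finset.filter_congr fun a' _ => openConn_iff_openConnIn_compl_of_not_openConn hoa'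
    have hhalf : 2 * (A.filter fun a' => ω ∈ (openConn a a' : Set (BondConfig (Fin n)))).card ≤
        A.card := by
      rw [hfilt]; exact hNoMaj a
    have hsplit := Finset.card_filter_add_card_filter_not (s := A)
      (fun a' => ω ∈ (openConn a a' : Set (BondConfig (Fin n))))
    have hcast : ((A.filter fun a' => ω ∈ (openConn a a' : Set (BondConfig (Fin n)))).card : ℝ) +
        ((A.filter fun a' => ¬ ω ∈ (openConn a a' : Set (BondConfig (Fin n)))).card : ℝ) = m := by
      rw [hm]; exact_mod_cast hsplit
    have hhalf' : 2 * ((A.filter fun a' => ω ∈ (openConn a a' : Set (BondConfig (Fin n)))).card : ℝ)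
        ≤ m := by
      rw [hm]; exact_mod_cast hhalf
    linarith
  have hsum : ∑ a' ∈ A, P.real (D ∩ (openConn a a' : Set (BondConfig (Fin n)))ᶜ) ≤ m * η := by
    calc ∑ a' ∈ A, P.real (D ∩ (openConn a a' : Set (BondConfig (Fin n)))ᶜ)
        ≤ ∑ a' ∈ A, η := Finset.sum_le_sum fun a' ha' =>
          (measureReal_mono Set.inter_subset_right (measure_ne_top _ _)).trans (hpair a' ha')
      _ = m * η := by rw [Finset.sum_const, nsmul_eq_mul, hm]
  have h2 : m / 2 * P.real D ≤ m / 2 * (2 * η) := by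
    calc m / 2 * P.real D ≤ m * η := hcount.trans hsum
      _ = m / 2 * (2 * η) := by ring
  exact le_of_mul_le_mul_left h2 (by positivity)

/-- **The no-majority class of the fat-minority stub (constant 4).** If `A ≠ ∅` and
`P(a ↮ a') ≤ η` for all `a, a' ∈ A`, then
`P({2N ≤ |A|} ∩ {no open cluster of G − o holds more than half of A}) ≤ 4η`:
on `{2N ≤ |A|}` at least `|A|/2` relays are missed by `o`, and each missed relay costs `≤ 2η` on
the no-majority class (`noMajority_notConn_le`). No `P(o ↮ A)` term and no finger threshold `d₀`
are needed on this class. [folklore] -/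
theorem minority_noMajority_le {n : ℕ} (w : Sym2 (Fin n) → unitInterval) (A : Finset (Fin n))
    (o : Fin n) (η : ℝ) (hA : A.Nonempty)
    (hpair : ∀ a ∈ A, ∀ a' ∈ A, (prodBernoulli w).real (openConn a a' : Set (BondConfig (Fin n)))ᶜ ≤ η) :
    (prodBernoulli w).real ({ω : BondConfig (Fin n) |
        2 * (A.filter fun a => ω ∈ openConn o a).card ≤ A.card} ∩
      {ω : BondConfig (Fin n) | ∀ v : Fin n,
        2 * (A.filter fun a' => ω ∈ openConnIn (({o} : Set (Fin n))ᶜ) v a').card ≤ A.card}) ≤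
      4 * η := by
  have hmeas : ∀ s : Set (BondConfig (Fin n)), MeasurableSet s :=
    fun _ => MeasurableSet.of_discrete
  set P := prodBernoulli w with hP
  set NoMaj : Set (BondConfig (Fin n)) := {ω : BondConfig (Fin n) | ∀ v : Fin n,
      2 * (A.filter fun a' => ω ∈ openConnIn (({o} : Set (Fin n))ᶜ) v a').card ≤ A.card} with hNM
  set D : Set (BondConfig (Fin n)) := {ω : BondConfig (Fin n) |
      2 * (A.filter fun a => ω ∈ openConn o a).card ≤ A.card} ∩ NoMaj with hD
  obtain ⟨a₁, ha₁⟩ := hA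
  set m : ℝ := (A.card : ℝ) with hm
  have hmpos : 0 < m := by rw [hm]; exact_mod_cast Finset.card_pos.2 ⟨a₁, ha₁⟩
  have hcount : m / 2 * P.real D ≤
      ∑ a ∈ A, P.real (D ∩ (openConn o a : Set (BondConfig (Fin n)))ᶜ) := by
    refine halfLeSevenForms_mul_measureReal_le_sum_inter P A
      (fun a => (openConn o a : Set (BondConfig (Fin n)))ᶜ) (fun _ _ => hmeas _) (hmeas D)
      (m / 2) fun ω hω => ?_
    have hind : ∀ a ∈ A,
        ((openConn o a : Set (BondConfig (Fin n)))ᶜ).indicator (fun _ => (1 : ℝ)) ω =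
          if ¬ ω ∈ (openConn o a : Set (BondConfig (Fin n))) then (1 : ℝ) else 0 := by
      intro a _
      by_cases h' : ω ∈ (openConn o a : Set (BondConfig (Fin n)))
      · rw [if_neg (not_not.2 h'), Set.indicator_of_notMem (Set.notMem_compl_iff.2 h')]
      · rw [if_pos h', Set.indicator_of_mem (show ω ∈ (openConn o a : Set (BondConfig (Fin n)))ᶜ
          from h')]
    rw [Finset.sum_congr rfl hind, Finset.sum_boole]
    obtain ⟨hmin, -⟩ := hω
    have hsplit := Finset.card_filter_add_card_filter_not (s := A)
      (fun a => ω ∈ (openConn o a : Set (BondConfig (Fin n))))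
    have hcast : ((A.filter fun a => ω ∈ (openConn o a : Set (BondConfig (Fin n)))).card : ℝ) +
        ((A.filter fun a => ¬ ω ∈ (openConn o a : Set (BondConfig (Fin n)))).card : ℝ) = m := by
      rw [hm]; exact_mod_cast hsplit
    have hmin' : 2 * ((A.filter fun a => ω ∈ (openConn o a : Set (BondConfig (Fin n)))).card : ℝ)
        ≤ m := by
      rw [hm]; exact_mod_cast hmin
    linarith
  have hsum : ∑ a ∈ A, P.real (D ∩ (openConn o a : Set (BondConfig (Fin n)))ᶜ) ≤ m * (2 * η) := by
    calc ∑ a ∈ A, P.real (D ∩ (openConn o a : Set (BondConfig (Fin n)))ᶜ)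
        ≤ ∑ a ∈ A, 2 * η := by
          refine Finset.sum_le_sum fun a ha => ?_
          calc P.real (D ∩ (openConn o a : Set (BondConfig (Fin n)))ᶜ)
              ≤ P.real (NoMaj ∩ (openConn o a : Set (BondConfig (Fin n)))ᶜ) :=
                measureReal_mono (fun ω hω => ⟨hω.1.2, hω.2⟩) (measure_ne_top _ _)
            _ ≤ 2 * η := noMajority_notConn_le w A o a η ha (hpair a ha)
      _ = m * (2 * η) := by rw [Finset.sum_const, nsmul_eq_mul, hm]
  have h2 : m / 2 * P.real D ≤ m / 2 * (4 * η) := by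
    calc m / 2 * P.real D ≤ m * (2 * η) := hcount.trans hsum
      _ = m / 2 * (4 * η) := by ring
  exact le_of_mul_le_mul_left h2 (by positivity)

/-! ## The residual: majority miss -/

/-- **Cover.** `{0 < N, 2N ≤ |A|} ⊆ ({2N ≤ |A|} ∩ NoMaj) ∪ MM`: if off `o` some cluster holds a
strict majority of the relays, an observer in the minority cannot be joined to it. [folklore] -/
theorem fatMinorityZero_subset_noMajority_union_majorityMiss {n : ℕ} (A : Finset (Fin n))
    (o : Fin n) :
    {ω : BondConfig (Fin n) | 0 < (A.filter fun a => ω ∈ openConn o a).card ∧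
        2 * (A.filter fun a => ω ∈ openConn o a).card ≤ A.card} ⊆
      (({ω : BondConfig (Fin n) | 2 * (A.filter fun a => ω ∈ openConn o a).card ≤ A.card} ∩
        {ω : BondConfig (Fin n) | ∀ v : Fin n,
          2 * (A.filter fun a' => ω ∈ openConnIn (({o} : Set (Fin n))ᶜ) v a').card ≤ A.card}) ∪
      {ω : BondConfig (Fin n) | ω ∈ (⋃ a ∈ A, (openConn o a : Set (BondConfig (Fin n)))) ∧
        ∃ v : Fin n, A.card < 2 * (A.filter fun a' =>
          ω ∈ openConnIn (({o} : Set (Fin n))ᶜ) v a').card ∧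
          ω ∉ (openConn o v : Set (BondConfig (Fin n)))}) := by
  rintro ω ⟨hpos, hmin⟩
  by_cases hmaj : ∃ v : Fin n,
      A.card < 2 * (A.filter fun a' => ω ∈ openConnIn (({o} : Set (Fin n))ᶜ) v a').card
  · obtain ⟨v, hv⟩ := hmaj
    right
    refine ⟨?_, v, hv, fun hov => ?_⟩
    · obtain ⟨a, ha⟩ := Finset.card_pos.1 hpos
      rw [Finset.mem_filter] at ha
      exact Set.mem_biUnion (Finset.mem_coe.2 ha.1) ha.2
    · have hsub : (A.filter fun a' => ω ∈ openConnIn (({o} : Set (Fin n))ᶜ) v a') ⊆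
          (A.filter fun a => ω ∈ openConn o a) := by
        intro a' ha'
        rw [Finset.mem_filter] at ha' ⊢
        exact ⟨ha'.1, openConn_of_openConn_of_openConnIn hov ha'.2⟩
      have := Finset.card_le_card hsub
      omega
  · left
    push Not at hmaj
    exact ⟨hmin, fun v => hmaj v⟩

/-- **Majority miss lies inside the fat minority.** `MM ⊆ {0 < N, 2N ≤ |A|}`: a relay joined to `o`
cannot lie in a cluster of `G − o` that `o` misses. [folklore] -/
theorem majorityMiss_subset_fatMinorityZero {n : ℕ} (A : Finset (Fin n)) (o : Fin n) :
    {ω : BondConfig (Fin n) | ω ∈ (⋃ a ∈ A, (openConn o a : Set (BondConfig (Fin n)))) ∧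
        ∃ v : Fin n, A.card < 2 * (A.filter fun a' =>
          ω ∈ openConnIn (({o} : Set (Fin n))ᶜ) v a').card ∧
          ω ∉ (openConn o v : Set (BondConfig (Fin n)))} ⊆
      {ω : BondConfig (Fin n) | 0 < (A.filter fun a => ω ∈ openConn o a).card ∧
        2 * (A.filter fun a => ω ∈ openConn o a).card ≤ A.card} := by
  rintro ω ⟨hU, v, hv, hov⟩
  refine ⟨?_, ?_⟩
  · obtain ⟨a, ha, hωa⟩ := Set.mem_iUnion₂.1 hU
    exact Finset.card_pos.2 ⟨a, Finset.mem_filter.2 ⟨Finset.mem_coe.1 ha, hωa⟩⟩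
  · have hdisj : Disjoint (A.filter fun a => ω ∈ openConn o a)
        (A.filter fun a' => ω ∈ openConnIn (({o} : Set (Fin n))ᶜ) v a') := by
      rw [Finset.disjoint_left]
      intro a ha ha'
      rw [Finset.mem_filter] at ha ha'
      refine hov ?_
      have h1 : (openGraph ω).Reachable o a := ha.2
      have h2 : (openGraph ω).Reachable v a := openConnIn_subset_openConn _ _ _ ha'.2
      exact h1.trans h2.symm
    have hle : ((A.filter fun a => ω ∈ openConn o a) ∪
        (A.filter fun a' => ω ∈ openConnIn (({o} : Set (Fin n))ᶜ) v a')).card ≤ A.card :=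
      Finset.card_le_card (Finset.union_subset (Finset.filter_subset _ _) (Finset.filter_subset _ _))
    rw [Finset.card_union_of_disjoint hdisj] at hle
    omega

/-- **Majority miss ⟹ the fat-minority stub** (`d₀ = 0`, constant `C + 4`): the bound
`P(MM) ≤ C (P(o ↮ A) + η)` on the one-cut-at-the-observer event implies the registered stub
`stub_fatMinorityLinear`, the no-majority class costing `4η` (`minority_noMajority_le`).
[folklore] -/
theorem fatMinorityLinear_of_majorityMiss :
    (∃ C : ℝ, 0 ≤ C ∧ ∀ (n : ℕ) (w : Sym2 (Fin n) → unitInterval) (A : Finset (Fin n)) (o : Fin n) (η : ℝ), 0 ≤ η → o ∉ A → (∀ a ∈ A, ∀ a' ∈ A, (Literature.Probability.LatticeModels.prodBernoulli w).real (Literature.Probability.Percolation.openConn a a')ᶜ ≤ η) → (Literature.Probability.LatticeModels.prodBernoulli w).real {ω : Literature.Probability.Percolation.BondConfig (Fin n) | ω ∈ (⋃ a ∈ A, (Literature.Probability.Percolation.openConn o a : Set (Literature.Probability.Percolation.BondConfig (Fin n)))) ∧ ∃ v : Fin n, A.card < 2 * (A.filter fun a' => ω ∈ Literature.Probability.Percolation.openConnIn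 (({o} : Set (Fin n))ᶜ) v a').card ∧ ω ∉ (Literature.Probability.Percolation.openConn o v : Set (Literature.Probability.Percolation.BondConfig (Fin n)))} ≤ C * ((Literature.Probability.LatticeModels.prodBernoulli w).real (⋃ a ∈ A, Literature.Probability.Percolation.openConn o a)ᶜ + η)) →
    (∃ (d₀ : ℕ) (C : ℝ), 0 ≤ C ∧ ∀ (n : ℕ) (w : Sym2 (Fin n) → unitInterval) (A : Finset (Fin n)) (o : Fin n) (η : ℝ), 0 ≤ η → o ∉ A → (∀ a ∈ A, ∀ a' ∈ A, (Literature.Probability.LatticeModels.prodBernoulli w).real (Literature.Probability.Percolation.openConn a a')ᶜ ≤ η) → (Literature.Probability.LatticeModels.prodBernoulli w).real {ω : Literature.Probability.Percolation.BondConfig (Fin n) | d₀ < (A.filter fun a => ω ∈ Literature.Probability.Percolation.openConn o a).card ∧ 2 * (A.filter fun a => ω ∈ Literature.Probability.Percolation.openConn o a).card ≤ A.card} ≤ C * ((Literature.Probability.LatticeModels.prodBernoulli w).real (⋃ a ∈ A, Literature.Probability.Percolation.openConn o a)ᶜ + η)) := by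
  rintro ⟨C, hC, hMM⟩
  refine ⟨0, C + 4, by positivity, fun n w A o η hη ho hpair => ?_⟩
  rcases A.eq_empty_or_nonempty with hAe | hAne
  · subst hAe
    have hempty : {ω : BondConfig (Fin n) |
        0 < ((∅ : Finset (Fin n)).filter fun a => ω ∈ openConn o a).card ∧
          2 * ((∅ : Finset (Fin n)).filter fun a => ω ∈ openConn o a).card ≤
            (∅ : Finset (Fin n)).card} = ∅ := by
      ext ω
      simp
    rw [hempty, measureReal_empty]
    exact mul_nonneg (by positivity) (add_nonneg measureReal_nonneg hη)
  have h1 := minority_noMajority_le w A o η hAne hpair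
  have h2 := hMM n w A o η hη ho hpair
  have h0 : 0 ≤ (prodBernoulli w).real (⋃ a ∈ A, (openConn o a : Set (BondConfig (Fin n))))ᶜ :=
    measureReal_nonneg
  calc (prodBernoulli w).real {ω : BondConfig (Fin n) |
          0 < (A.filter fun a => ω ∈ openConn o a).card ∧
            2 * (A.filter fun a => ω ∈ openConn o a).card ≤ A.card}
      ≤ (prodBernoulli w).real
          ((({ω : BondConfig (Fin n) | 2 * (A.filter fun a => ω ∈ openConn o a).card ≤ A.card} ∩
            {ω : BondConfig (Fin n) | ∀ v : Fin n,
              2 * (A.filter fun a' => ω ∈ openConnIn (({o} : Set (Fin n))ᶜ) v a').card ≤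
                A.card}) ∪
          {ω : BondConfig (Fin n) | ω ∈ (⋃ a ∈ A, (openConn o a : Set (BondConfig (Fin n)))) ∧
            ∃ v : Fin n, A.card < 2 * (A.filter fun a' =>
              ω ∈ openConnIn (({o} : Set (Fin n))ᶜ) v a').card ∧
              ω ∉ (openConn o v : Set (BondConfig (Fin n)))})) :=
        measureReal_mono (fatMinorityZero_subset_noMajority_union_majorityMiss A o)
          (measure_ne_top _ _)
    _ ≤ 4 * η + C * ((prodBernoulli w).real
          (⋃ a ∈ A, (openConn o a : Set (BondConfig (Fin n))))ᶜ + η) :=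
        (measureReal_union_le _ _).trans (add_le_add h1 h2)
    _ ≤ (C + 4) * ((prodBernoulli w).real
          (⋃ a ∈ A, (openConn o a : Set (BondConfig (Fin n))))ᶜ + η) := by
        nlinarith

/-- **Majority miss ⟹ the crux `NoHeavyLowerTail`** (through the fat-minority stub and the landed
`noHeavyLowerTail_of_fatMinorityLinear`). [folklore] -/
theorem noHeavyLowerTail_of_majorityMiss
    (hMM : ∃ C : ℝ, 0 ≤ C ∧ ∀ (n : ℕ) (w : Sym2 (Fin n) → unitInterval) (A : Finset (Fin n)) (o : Fin n) (η : ℝ), 0 ≤ η → o ∉ A → (∀ a ∈ A, ∀ a' ∈ A, (Literature.Probability.LatticeModels.prodBernoulli w).real (Literature.Probability.Percolation.openConn a a')ᶜ ≤ η) → (Literature.Probability.LatticeModels.prodBernoulli w).real {ω : Literature.Probability.Percolation.BondConfig (Fin n) | ω ∈ (⋃ a ∈ A, (Literature.Probability.Percolation.openConn o a : Set (Literature.Probability.Percolation.BondConfig (Fin n)))) ∧ ∃ v : Fin n, A.card < 2 * (A.filter fun a' => ω ∈ Literature.Probability.Percolation.openConnIn (({o} : Set (Fin n))ᶜ) v a').card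 ∧ ω ∉ (Literature.Probability.Percolation.openConn o v : Set (Literature.Probability.Percolation.BondConfig (Fin n)))} ≤ C * ((Literature.Probability.LatticeModels.prodBernoulli w).real (⋃ a ∈ A, Literature.Probability.Percolation.openConn o a)ᶜ + η)) :
    Summit.CriticalPhenomena.PercolationContinuityZ3.Theses.PercNearOneGluing.NoHeavyLowerTail :=
  noHeavyLowerTail_of_fatMinorityLinear (fatMinorityLinear_of_majorityMiss hMM)

/-- **The stub at `d₀ = 0` ⟹ majority miss** with the same constant (`MM ⊆ {0 < N, 2N ≤ |A|}`):
together with `fatMinorityLinear_of_majorityMiss`, the registered stub at `d₀ = 0` and the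
majority-miss bound are equivalent up to the additive constant `4`. [folklore] -/
theorem majorityMiss_of_fatMinorityZero {C : ℝ}
    (hF : ∀ (n : ℕ) (w : Sym2 (Fin n) → unitInterval) (A : Finset (Fin n)) (o : Fin n) (η : ℝ), 0 ≤ η → o ∉ A → (∀ a ∈ A, ∀ a' ∈ A, (Literature.Probability.LatticeModels.prodBernoulli w).real (Literature.Probability.Percolation.openConn a a')ᶜ ≤ η) → (Literature.Probability.LatticeModels.prodBernoulli w).real {ω : Literature.Probability.Percolation.BondConfig (Fin n) | 0 < (A.filter fun a => ω ∈ Literature.Probability.Percolation.openConn o a).card ∧ 2 * (A.filter fun a => ω ∈ Literature.Probability.Percolation.openConn o a).card ≤ A.card} ≤ C * ((Literature.Probability.LatticeModels.prodBernoulli w).real (⋃ a ∈ A, Literature.Probability.Percolation.openConn o a)ᶜ + η))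
    {n : ℕ} (w : Sym2 (Fin n) → unitInterval) (A : Finset (Fin n)) (o : Fin n) (η : ℝ)
    (hη : 0 ≤ η) (ho : o ∉ A)
    (hpair : ∀ a ∈ A, ∀ a' ∈ A, (prodBernoulli w).real (openConn a a' : Set (BondConfig (Fin n)))ᶜ ≤ η) :
    (prodBernoulli w).real {ω : BondConfig (Fin n) |
        ω ∈ (⋃ a ∈ A, (openConn o a : Set (BondConfig (Fin n)))) ∧
        ∃ v : Fin n, A.card < 2 * (A.filter fun a' =>
          ω ∈ openConnIn (({o} : Set (Fin n))ᶜ) v a').card ∧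
          ω ∉ (openConn o v : Set (BondConfig (Fin n)))} ≤
      C * ((prodBernoulli w).real (⋃ a ∈ A, (openConn o a : Set (BondConfig (Fin n))))ᶜ + η) :=
  (measureReal_mono (majorityMiss_subset_fatMinorityZero A o) (measure_ne_top _ _)).trans
    (hF n w A o η hη ho hpair)

end Summit.CriticalPhenomena.PercolationContinuityZ3.Theorems

end
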